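import Summits.CriticalPhenomena.PercolationContinuityZ3.Theorems.PercNearOneGluingNoHeavyLowerTailApexForestBridgeSides
import HarnessLib

/-!
# Kozma–Nitzan Conjectures 1–2 on APEX-FOREST graphs — semantic bridge, part 2: side decomposition from any vertex; the event identity for `{o ↮ c}`
# (`NoHeavyLowerTail` cell, stmt-CriticalPhenomena-4575; new-inequality factory seat `prim-ineq-gen-7`, gen 3)

Support file (`--supports stmt-CriticalPhenomena-4575`).  Deterministic lemmas; no measure theory, no definitions, no named facts, no sorries.
Continues `…ApexForestBridgeSides` (plan run/shared/lean/prim/prim-ineq-gen-7/LEAN-PLAN-APEXFOREST.md, steps L2–L3):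

* `ApexForestBridge.openConnIn_compl_hub_iff_of_side` — for a bridge `e = s(y₁,y₂)` of `fromEdgeSet D` and ANY vertex `x` of the `y₁`-side:
  `x ↔ u` off `c` iff `x ↔ u` inside the `y₁`-side, or `e` is open, `x ↔ y₁` inside the `y₁`-side and `y₂ ↔ u` inside the `y₂`-side
  (needed for the relay formula `P(α ↮ c) = d_α − θ e_α` of the paper proofs);
* `ApexForestBridge.openConn_iff_openConnIn_compl_of_not_hub` — if `x ↮ c` then `x ↔ a` iff `x ↔ a` off `c`;
* `ApexForestBridge.not_openConn_hub_iff` — **(E1)**: `o ↮ c` iff all vertices joined to `o` inside its side have closed hub pairs and, if `e` is open, the same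
  for `v₁` inside its side — i.e. `{o ↮ c} = HC(S_o) ∩ ({e closed} ∪ HC(S₁))` with the two `HC` events read on DISJOINT sets of pairs.
[cite: Grimmett1999, §1.3 (open paths and clusters)]
-/

namespace Summit.CriticalPhenomena.PercolationContinuityZ3.Theorems

namespace ApexForestBridge

open Literature.Probability.Percolation ApexForestWalks

variable {V : Type*} [DecidableEq V]

/-! ### Part 2: side decomposition from an arbitrary vertex of one side, and the three event identities -/

/-- **Side decomposition from any vertex of a side.**  Bridge `e = s(y₁, y₂) ∈ D` of `fromEdgeSet D`, sides `S₁ ∋ y₁`, `S₂ ∋ y₂` (components of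
`fromEdgeSet (D ∖ {e})`), `x ∈ S₁`, every open pair in `D` or containing `c`.  Then `x` is joined to `u` off `c` iff it is joined to `u` inside `S₁`, or
`e` is open, `x` is joined to `y₁` inside `S₁` and `y₂` is joined to `u` inside `S₂`. [folklore] -/
theorem openConnIn_compl_hub_iff_of_side {ω : BondConfig V} {D : Set (Sym2 V)} {c y₁ y₂ x : V}
    (hDc : ∀ p ∈ D, c ∉ p) (hy : y₁ ≠ y₂) (he : s(y₁, y₂) ∈ D)
    (hbridge : ¬ (SimpleGraph.fromEdgeSet (D \ {s(y₁, y₂)})).Reachable y₁ y₂)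
    (hx : (SimpleGraph.fromEdgeSet (D \ {s(y₁, y₂)})).Reachable y₁ x)
    (hω : ∀ p ∈ ω, p ∈ D ∨ c ∈ p) (u : V) :
    ω ∈ openConnIn ({c}ᶜ : Set V) x u ↔
      ω ∈ openConnIn {z | (SimpleGraph.fromEdgeSet (D \ {s(y₁, y₂)})).Reachable y₁ z} x u ∨
        (s(y₁, y₂) ∈ ω ∧ ω ∈ openConnIn {z | (SimpleGraph.fromEdgeSet (D \ {s(y₁, y₂)})).Reachable y₁ z} x y₁ ∧
          ω ∈ openConnIn {z | (SimpleGraph.fromEdgeSet (D \ {s(y₁, y₂)})).Reachable y₂ z} y₂ u) := by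
  set F' := SimpleGraph.fromEdgeSet (D \ {s(y₁, y₂)}) with hF'
  have hy₁c : y₁ ≠ c := fun h => hDc _ he (h ▸ Sym2.mem_mk_left y₁ y₂)
  have hy₂c : y₂ ≠ c := fun h => hDc _ he (h ▸ Sym2.mem_mk_right y₁ y₂)
  have hcF' : ∀ a b, F'.Reachable a b → a ≠ c → b ≠ c := by
    intro a b hab hac hbc
    subst hbc
    rw [SimpleGraph.reachable_iff_reflTransGen] at hab
    rcases Relation.ReflTransGen.cases_tail hab with h | ⟨z, _, hzc⟩
    · exact hac h.symm
    · have := (SimpleGraph.fromEdgeSet_adj _).1 hzc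
      exact hDc _ this.1.1 (Sym2.mem_mk_right z b)
  have hxc : x ≠ c := hcF' y₁ x hx hy₁c
  have hS₁ : {z | F'.Reachable y₁ z} ⊆ ({c}ᶜ : Set V) := fun z hz hzc => hcF' y₁ z hz hy₁c (by simpa using hzc)
  have hS₂ : {z | F'.Reachable y₂ z} ⊆ ({c}ᶜ : Set V) := fun z hz hzc => hcF' y₂ z hz hy₂c (by simpa using hzc)
  -- the side of `x` is the side of `y₁`
  have hside : {z | F'.Reachable x z} = {z | F'.Reachable y₁ z} := by
    ext z; exact ⟨fun h => hx.trans h, fun h => hx.symm.trans h⟩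
  constructor
  · intro h
    obtain ⟨huc, hR⟩ := reachable_inter_of_openConnIn_compl hω hxc h
    set ω₀ : BondConfig V := ω ∩ (D \ {s(y₁, y₂)}) with hω₀
    have hω₀D : ω₀ ⊆ D \ {s(y₁, y₂)} := Set.inter_subset_right
    have hω₀ω : ω₀ ⊆ ω := Set.inter_subset_left
    have hstay : ∀ {a b : V} (p : (openGraph ω₀).Walk a b), ω ∈ openConnIn {z | F'.Reachable a z} a b := by
      intro a b p
      exact openConnIn_mono_config hω₀ω
        (pathIn_of_walk_support p (fun z hz => reachable_fromEdgeSet_of_mem_support hω₀D p hz))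
    -- `x` (on the `y₁` side) is not `ω₀`-joined to `y₂`
    have hnot : ¬ (openGraph ω₀).Reachable x y₂ := by
      rintro ⟨p⟩
      exact hbridge (hx.trans (reachable_fromEdgeSet_of_mem_support hω₀D p p.end_mem_support))
    by_cases heω : s(y₁, y₂) ∈ ω
    · have hset : ω ∩ D = insert s(y₁, y₂) ω₀ := by
        ext p
        simp only [hω₀, Set.mem_inter_iff, Set.mem_insert_iff, Set.mem_sdiff, Set.mem_singleton_iff]
        constructor
        · rintro ⟨hp, hpD⟩
          by_cases hpe : p = s(y₁, y₂)
          · exact Or.inl hpe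
          · exact Or.inr ⟨hp, hpD, hpe⟩
        · rintro (rfl | ⟨hp, hpD, _⟩)
          · exact ⟨heω, he⟩
          · exact ⟨hp, hpD⟩
      rw [hset] at hR
      rcases ((reachable_insert_iff ω₀ hy x u).1 hR) with h0 | ⟨h1, h2⟩ | ⟨h1, _⟩
      · left; obtain ⟨p⟩ := h0; rw [← hside]; exact hstay p
      · right
        obtain ⟨p₁⟩ := h1; obtain ⟨p₂⟩ := h2
        refine ⟨heω, ?_, hstay p₂⟩
        rw [← hside]; exact hstay p₁
      · exact absurd h1 hnot
    · have hset : ω ∩ D = ω₀ := by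
        ext p
        simp only [hω₀, Set.mem_inter_iff, Set.mem_sdiff, Set.mem_singleton_iff]
        constructor
        · rintro ⟨hp, hpD⟩
          refine ⟨hp, hpD, ?_⟩
          rintro rfl
          exact heω hp
        · rintro ⟨hp, hpD, _⟩
          exact ⟨hp, hpD⟩
      rw [hset] at hR
      left; obtain ⟨p⟩ := hR; rw [← hside]; exact hstay p
  · rintro (h | ⟨heω, h1, h2⟩)
    · exact openConnIn_mono_set hS₁ h
    · have h1' : ω ∈ openConnIn ({c}ᶜ : Set V) x y₁ := openConnIn_mono_set hS₁ h1
      have h2' : ω ∈ openConnIn ({c}ᶜ : Set V) y₂ u := openConnIn_mono_set hS₂ h2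
      have hadj : (openGraph ω).Adj y₁ y₂ := (openGraph_adj ω y₁ y₂).2 ⟨heω, hy⟩
      -- concatenate: x ⇝ y₁ (in {c}ᶜ), step y₁ → y₂, y₂ ⇝ u
      have hp1 := DCT16.pathIn_of_mem_openConnIn h1'
      have hp2 := DCT16.pathIn_of_mem_openConnIn h2'
      refine DCT16.mem_openConnIn_of_pathIn ⟨hp1.1, ?_⟩
      exact (hp1.2.tail ⟨hadj, by simpa using hy₂c⟩).trans hp2.2

omit [DecidableEq V] in
/-- Off the hub, reachability is reachability avoiding `c`: if `x ↮ c` then `x ↔ a` iff `x ↔ a` off `c`. [folklore] -/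
theorem openConn_iff_openConnIn_compl_of_not_hub {ω : BondConfig V} {x c a : V}
    (hxc : ω ∉ (openConn x c : Set (BondConfig V))) :
    ω ∈ (openConn x a : Set (BondConfig V)) ↔ ω ∈ openConnIn ({c}ᶜ : Set V) x a := by
  constructor
  · intro h
    refine KNGoodAux.openConnIn_of_reachable_of_forall_mem h fun y hy hyc => hxc ?_
    have : y = c := by simpa using hyc
    subst this
    exact hy
  · exact KNPreFKG.reachable_of_openConnIn

/-- **Event identity (E1): `{o ↮ c}` across the bridge.**  With the hypotheses of `openConnIn_compl_hub_iff`: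
`o ↮ c` iff every vertex joined to `o` inside `S_o` has its hub pair closed, and, if `e` is open, the same for `v₁` inside `S₁`. [folklore] -/
theorem not_openConn_hub_iff {ω : BondConfig V} {D : Set (Sym2 V)} {c o v₁ : V}
    (hDc : ∀ p ∈ D, c ∉ p) (hov : o ≠ v₁) (he : s(o, v₁) ∈ D)
    (hbridge : ¬ (SimpleGraph.fromEdgeSet (D \ {s(o, v₁)})).Reachable o v₁)
    (hω : ∀ p ∈ ω, p ∈ D ∨ c ∈ p) :
    ω ∉ (openConn o c : Set (BondConfig V)) ↔
      (∀ u, ω ∈ openConnIn {x | (SimpleGraph.fromEdgeSet (D \ {s(o, v₁)})).Reachable o x} o u → s(u, c) ∉ ω) ∧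
        (s(o, v₁) ∈ ω → ∀ u, ω ∈ openConnIn {x | (SimpleGraph.fromEdgeSet (D \ {s(o, v₁)})).Reachable v₁ x} v₁ u → s(u, c) ∉ ω) := by
  have hoc : o ≠ c := fun h => hDc _ he (h ▸ Sym2.mem_mk_left o v₁)
  have key : ω ∈ (openConn o c : Set (BondConfig V)) ↔
      ∃ u, u ≠ c ∧ (ω ∈ openConnIn {x | (SimpleGraph.fromEdgeSet (D \ {s(o, v₁)})).Reachable o x} o u ∨
        (s(o, v₁) ∈ ω ∧ ω ∈ openConnIn {x | (SimpleGraph.fromEdgeSet (D \ {s(o, v₁)})).Reachable v₁ x} v₁ u)) ∧ s(u, c) ∈ ω := by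
    rw [openConn_hub_iff ω hoc]
    constructor
    · rintro ⟨u, huc, hu, hsc⟩
      exact ⟨u, huc, (openConnIn_compl_hub_iff hDc hov he hbridge hω u).1 hu, hsc⟩
    · rintro ⟨u, huc, hu, hsc⟩
      exact ⟨u, huc, (openConnIn_compl_hub_iff hDc hov he hbridge hω u).2 hu, hsc⟩
  have hv₁c : v₁ ≠ c := fun h => hDc _ he (h ▸ Sym2.mem_mk_right o v₁)
  -- no vertex of either side is `c` (`c` has no `D`-pairs)
  have hcF' : ∀ a b, (SimpleGraph.fromEdgeSet (D \ {s(o, v₁)})).Reachable a b → a ≠ c → b ≠ c := by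
    intro a b hab hac hbc
    subst hbc
    rw [SimpleGraph.reachable_iff_reflTransGen] at hab
    rcases Relation.ReflTransGen.cases_tail hab with h' | ⟨z, _, hzc⟩
    · exact hac h'.symm
    · exact hDc _ ((SimpleGraph.fromEdgeSet_adj _).1 hzc).1.1 (Sym2.mem_mk_right z b)
  have hne_o : ∀ u, ω ∈ openConnIn {x | (SimpleGraph.fromEdgeSet (D \ {s(o, v₁)})).Reachable o x} o u → u ≠ c :=
    fun u hu => hcF' o u (DCT16.pathIn_of_mem_openConnIn hu).right_mem hoc
  have hne_1 : ∀ u, ω ∈ openConnIn {x | (SimpleGraph.fromEdgeSet (D \ {s(o, v₁)})).Reachable v₁ x} v₁ u → u ≠ c :=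
    fun u hu => hcF' v₁ u (DCT16.pathIn_of_mem_openConnIn hu).right_mem hv₁c
  rw [key]
  constructor
  · intro h
    exact ⟨fun u hu hsc => h ⟨u, hne_o u hu, Or.inl hu, hsc⟩, fun heω u hu hsc => h ⟨u, hne_1 u hu, Or.inr ⟨heω, hu⟩, hsc⟩⟩
  · rintro ⟨h1, h2⟩ ⟨u, _, hu | ⟨heω, hu⟩, hsc⟩
    · exact h1 u hu hsc
    · exact h2 heω u hu hsc

end ApexForestBridge

end Summit.CriticalPhenomena.PercolationContinuityZ3.Theorems
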